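import Literature.MathematicalPhysics.QuantumLattice.PairedProductStates
import Literature.MathematicalPhysics.QuantumLattice.BdGPairBlock
import Literature.MathematicalPhysics.QuantumLattice.FinDimSpectrumSectorGibbsLimit
import Literature.MathematicalPhysics.QuantumLattice.FermionOperatorsNumberEigenspaceProofs
import HarnessLib

/-!
# Occupation-diagonal states carry no `d`-wave pair-field long-range order (free Fermi gas, `U = 0`)

Family `hubbard` / trunk T-QLATTICE. A basis-free replacement for "plane-wave Slater basis + Wick"
on the fermionic torus `(ℤ/Lℤ)²`:

* **Diagonal-ensemble selection rule** (`trace_mul_conjTranspose_pairMode_mul_pairMode_of_ne`): for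
  ANY matrix `P` commuting with the Bloch occupation number `n_{k'↑}`, the cross pair correlation
  `tr (P b_k† b_{k'})`, `b_k = c_{-k↓} c_{k↑}` (`pairMode`), vanishes for `k ≠ k'` — insert
  `c_{k'↑} = c_{k'↑} n_{k'↑}`, cycle `n_{k'↑}` through `P`, and `n_{k'↑} c_{k'↑} = 0`; the diagonal
  term is `b_k† b_k = n_{k↑} n_{-k↓}` (`conjTranspose_pairMode_mul_self`). Hence
  `tr (P B(ĝ,S)† B(ĝ,S)) = Σ_{k∈S} ĝ(k)² tr (P n_{k↑} n_{-k↓})`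
  (`trace_mul_conjTranspose_pairOperator_mul_pairOperator`) — "Wick's rule" for occupation-diagonal
  weights, with no Slater basis and no quasi-freeness.
* **No pair LRO** (`re_trace_mul_conjTranspose_pairField_dWave_mul_le`): for a Hermitian idempotent
  `P` commuting with every `n_{kσ}`, `Re tr (P Δ_d† Δ_d) ≤ 32 · L² · Re tr P` for the tree's
  `d_{x²-y²}` pair field `Δ_d = pairField dWaveFormFactor L = -2√2 Σ_k ĝ_d(k) b_k`
  (`pairField_dWave_eq_smul_pairOperator`; `0 ≤ tr (P n_{k↑}n_{-k↓}) ≤ tr P`, `ĝ_d² ≤ 4`): an `L²`,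
  not `L⁴`, law.
* **The free Hubbard torus** (`L ≥ 3`, `H(1,0) = Σ_{kσ} ε_L(k) n_{kσ}`,
  `hubbardTorus_zero_eq_sum_momentumNumber`): every `n_{kσ}` commutes with `H(1,0)`, `N` and `S^z`,
  so it leaves each joint sector eigenspace `szSector N M ⊓ ker (H(1,0) - e)` invariant and commutes
  with its orthogonal projection (`projMatrix_map_commute_of_invariant`); therefore
  `Re tr (P_E Δ_d† Δ_d) ≤ 32 L² Re tr P_E` for every such `E`
  (`re_trace_sectorEigenProj_mul_pairField_dWave_le_free`): the free Fermi gas has NO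
  ground-state-average (nor excited-multiplet-average) `d`-wave pair LRO in any `(N, S^z)` sector,
  degenerate open shells included.

Context: this is the `U = 0` endpoint of the target `BirGroundStateAverageLRO` of route
`HubbardSuperconductivity/BalabanIR` (which asks `c·L⁴·Re tr P ≤ Re tr (P Δ_d†Δ_d)` on a window of
couplings `0 < U₁ < U < U₂`): the inequality fails at `U = 0` once `L² > 32/c`, so the window's
`0 < U₁` is load-bearing (recorded as a sorried near-miss in the crux's `Disproof.lean` §4, which
asked for a momentum-space Wick theorem; none is needed). Grand-canonical twin (order parameter):
`FreeFermiGasNoDWaveOrder.lean`.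

Sources: J. Bardeen, L. N. Cooper, J. R. Schrieffer, Phys. Rev. 108 (1957) 1175, §II (pair
correlations of the normal Fermi sea are `O(1)` per mode); C. N. Yang, Rev. Mod. Phys. 34 (1962)
694, §3 (no ODLRO for free fermions: `ρ₂` of a Slater determinant has bounded eigenvalues);
J. von Delft, D. C. Ralph, Phys. Rep. 345 (2001) 61, §4.2.3 (hard-core pair algebra `b_j`,
`b_j† b_j = n_{j+} n_{j-}` on the unblocked subspace); D. J. Scalapino, Phys. Rep. 250 (1995) 329,
§2 (the `d_{x²-y²}` pair field). Folklore finite-dimensional statements; no named facts, no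
definitions.

## Mathlib / tree search

Tree (`lean search` / read): `momentumAnnihilation`, `momentumNumber`, `pairMode`, `pairOperator`,
`momentumAnnihilation_mul_momentumCreation`, `momentumAnnihilation_mul_self`,
`momentumCreation_mul_eq_neg`, `hubbardTorus_zero_eq_sum_momentumNumber`,
`spinWeightedNumber_commute_momentumNumber`, `totalNumber_eq_spinWeightedNumber`,
`spinZ_eq_spinWeightedNumber` (`ReducedBCSTorus`); `momentumNumber_mul_momentumCreation_of_ne`
(`PairedProductStates`); `pairField_dWave_eq_smul_pairOperator`, `dWaveGap` (`PatchPairOperator`);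
`projMatrix`, `projMatrix_isHermitian`, `projMatrix_mul_self`, `projMatrix_map_commute_of_invariant`
(`FinDimSpectrum`, `FinDimSpectrumSectorGibbsLimit`); `szSector`, `nParticleSubmodule_eq_eigenspace_holds`,
`totalNumberOp_eq_totalNumber`; `card_torusSite`. Mathlib: `Matrix.posSemidef_conjTranspose_mul_self`,
`Matrix.PosSemidef.trace_nonneg`, `Matrix.trace_mul_comm`, `Commute.sum_right`.
-/

noncomputable section

namespace Literature.MathematicalPhysics.QuantumLattice

open Matrix Finset Literature.Probability.LatticeModels
open scoped ComplexOrder ComplexConjugate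

/-! ### Traces against commuting Hermitian idempotents -/

section Proj

variable {n : Type*} [Fintype n]

/-- The trace of a Hermitian idempotent is nonnegative (`Q = Qᴴ Q ≥ 0`). [folklore] -/
theorem trace_nonneg_of_conjTranspose_eq_of_mul_self {Q : Matrix n n ℂ} (hQ : Qᴴ = Q)
    (hQQ : Q * Q = Q) : 0 ≤ Q.trace := by
  have h : Q = Qᴴ * Q := by rw [hQ, hQQ]
  rw [h]
  exact (posSemidef_conjTranspose_mul_self Q).trace_nonneg

/-- The product of two COMMUTING Hermitian idempotents is a Hermitian idempotent. [folklore] -/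
theorem proj_mul_proj_of_commute {P A : Matrix n n ℂ} (hP : Pᴴ = P) (hPP : P * P = P)
    (hA : Aᴴ = A) (hAA : A * A = A) (h : Commute P A) :
    (P * A)ᴴ = P * A ∧ P * A * (P * A) = P * A := by
  refine ⟨by rw [conjTranspose_mul, hA, hP, ← h.eq], ?_⟩
  calc P * A * (P * A) = P * (A * P) * A := by simp only [Matrix.mul_assoc]
    _ = P * (P * A) * A := by rw [← h.eq]
    _ = P * A := by rw [← Matrix.mul_assoc, hPP, Matrix.mul_assoc, hAA]

/-- For commuting Hermitian idempotents `P`, `A`: `0 ≤ Re tr (P A)`. [folklore] -/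
theorem re_trace_mul_nonneg_of_commute {P A : Matrix n n ℂ} (hP : Pᴴ = P) (hPP : P * P = P)
    (hA : Aᴴ = A) (hAA : A * A = A) (h : Commute P A) : 0 ≤ (P * A).trace.re := by
  obtain ⟨h1, h2⟩ := proj_mul_proj_of_commute hP hPP hA hAA h
  exact (Complex.le_def.1 (trace_nonneg_of_conjTranspose_eq_of_mul_self h1 h2)).1

/-- For commuting Hermitian idempotents `P`, `A`: `Re tr (P A) ≤ Re tr P` (apply the previous
lemma to the complementary idempotent `1 - A`). [folklore] -/
theorem re_trace_mul_le_of_commute [DecidableEq n] {P A : Matrix n n ℂ} (hP : Pᴴ = P)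
    (hPP : P * P = P) (hA : Aᴴ = A) (hAA : A * A = A) (h : Commute P A) :
    (P * A).trace.re ≤ P.trace.re := by
  have hB : (1 - A)ᴴ = 1 - A := by rw [conjTranspose_sub, conjTranspose_one, hA]
  have hBB : (1 - A) * (1 - A) = 1 - A := by
    rw [Matrix.sub_mul, Matrix.one_mul, Matrix.mul_sub, Matrix.mul_one, hAA, sub_self, sub_zero]
  have hc : Commute P (1 - A) := (Commute.one_right P).sub_right h
  have h0 := re_trace_mul_nonneg_of_commute hP hPP hB hBB hc
  rw [Matrix.mul_sub, Matrix.mul_one, trace_sub, Complex.sub_re] at h0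
  linarith

/-- A matrix commuting with `T` maps each eigenspace of `T` into itself. [folklore] -/
theorem mulVec_mem_eigenspace_of_commute [DecidableEq n] {A T : Matrix n n ℂ} (h : Commute A T)
    {μ : ℂ} {v : n → ℂ} (hv : v ∈ Module.End.eigenspace (Matrix.toLin' T) μ) :
    A *ᵥ v ∈ Module.End.eigenspace (Matrix.toLin' T) μ := by
  rw [Module.End.mem_eigenspace_iff, Matrix.toLin'_apply] at hv ⊢
  rw [mulVec_mulVec, ← h.eq, ← mulVec_mulVec, hv, mulVec_smul]

end Proj

/-! ### Operators conserving `N` and `S^z` preserve the joint sectors -/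

section Sector

variable {Λ : Type*} [LinearOrder Λ] [Fintype Λ]

/-- An operator commuting with the particle number `N` and with `S^z` maps every joint sector
`szSector N M` into itself. Lieb, PRL 62 (1989) 1201. [folklore] -/
theorem mulVec_mem_szSector_of_commute {A : Matrix (Finset (Orb Λ)) (Finset (Orb Λ)) ℂ}
    (hN : Commute A totalNumber) (hS : Commute A HubbardWave0.spinZ) {N : ℕ} {M : ℝ}
    {v : Fock (Orb Λ)} (hv : v ∈ szSector N M) : A *ᵥ v ∈ szSector N M := by
  unfold szSector at hv ⊢
  rw [Submodule.mem_inf] at hv ⊢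
  refine ⟨?_, mulVec_mem_eigenspace_of_commute hS hv.2⟩
  have h1 := hv.1
  rw [nParticleSubmodule_eq_eigenspace_holds N] at h1 ⊢
  have hN' : Commute A (totalNumberOp : Matrix (Finset (Orb Λ)) (Finset (Orb Λ)) ℂ) := by
    rw [totalNumberOp_eq_totalNumber]; exact hN
  exact mulVec_mem_eigenspace_of_commute hN' h1

end Sector

/-! ### Complements on the Bloch occupation numbers `n_{kσ}` -/

section MomentumNumber

variable {L : ℕ} [NeZero L]

/-- `n_{kσ} c_{k'σ'} = c_{k'σ'} n_{kσ}` for different modes. [folklore] -/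
theorem momentumNumber_mul_momentumAnnihilation_of_ne {k k' : TorusSite 2 L} {σ σ' : Fin 2}
    (h : ¬ (k = k' ∧ σ = σ')) :
    momentumNumber k σ * momentumAnnihilation k' σ' =
      momentumAnnihilation k' σ' * momentumNumber k σ := by
  have h1 := congrArg conjTranspose (momentumNumber_mul_momentumCreation_of_ne h)
  rw [conjTranspose_mul, conjTranspose_mul, momentumCreation_conjTranspose,
    momentumNumber_conjTranspose] at h1
  exact h1.symm

/-- `n_{kσ} c_{kσ} = 0` (Pauli). [folklore] -/
theorem momentumNumber_mul_momentumAnnihilation_self (k : TorusSite 2 L) (σ : Fin 2) :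
    momentumNumber k σ * momentumAnnihilation k σ = 0 := by
  rw [momentumNumber, Matrix.mul_assoc, momentumAnnihilation_mul_self, Matrix.mul_zero]

/-- `c_{kσ} n_{kσ} = c_{kσ}`. [folklore] -/
theorem momentumAnnihilation_mul_momentumNumber_self (k : TorusSite 2 L) (σ : Fin 2) :
    momentumAnnihilation k σ * momentumNumber k σ = momentumAnnihilation k σ := by
  rw [momentumNumber, ← Matrix.mul_assoc, momentumAnnihilation_mul_momentumCreation,
    if_pos ⟨rfl, rfl⟩, Matrix.sub_mul, Matrix.one_mul, Matrix.mul_assoc,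
    momentumAnnihilation_mul_self, Matrix.mul_zero, sub_zero]

/-- `n_{kσ}² = n_{kσ}`. [folklore] -/
theorem momentumNumber_mul_self (k : TorusSite 2 L) (σ : Fin 2) :
    momentumNumber k σ * momentumNumber k σ = momentumNumber k σ := by
  conv_lhs => arg 1; rw [momentumNumber]
  rw [Matrix.mul_assoc, momentumAnnihilation_mul_momentumNumber_self, ← momentumNumber]

/-- The Bloch occupation numbers commute: `n_{kσ} n_{k'σ'} = n_{k'σ'} n_{kσ}`. [folklore] -/
theorem momentumNumber_commute (k k' : TorusSite 2 L) (σ σ' : Fin 2) :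
    Commute (momentumNumber k σ) (momentumNumber k' σ') := by
  change momentumNumber k σ * momentumNumber k' σ' = momentumNumber k' σ' * momentumNumber k σ
  by_cases h : k = k' ∧ σ = σ'
  · obtain ⟨rfl, rfl⟩ := h
    rfl
  · conv_lhs => arg 2; rw [momentumNumber]
    conv_rhs => arg 1; rw [momentumNumber]
    rw [← Matrix.mul_assoc, momentumNumber_mul_momentumCreation_of_ne h, Matrix.mul_assoc,
      momentumNumber_mul_momentumAnnihilation_of_ne h, ← Matrix.mul_assoc]

/-- `n_{kσ}` conserves the particle number. [folklore] -/
theorem momentumNumber_commute_totalNumber (k : TorusSite 2 L) (σ : Fin 2) :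
    Commute (momentumNumber k σ) totalNumber := by
  rw [totalNumber_eq_spinWeightedNumber]
  exact (spinWeightedNumber_commute_momentumNumber _ k σ).symm

/-- `n_{kσ}` conserves `S^z`. [folklore] -/
theorem momentumNumber_commute_spinZ (k : TorusSite 2 L) (σ : Fin 2) :
    Commute (momentumNumber k σ) HubbardWave0.spinZ := by
  rw [spinZ_eq_spinWeightedNumber]
  exact (spinWeightedNumber_commute_momentumNumber _ k σ).symm

/-- `n_{kσ}` maps every joint sector `szSector N M` into itself. [folklore] -/
theorem momentumNumber_mulVec_mem_szSector (k : TorusSite 2 L) (σ : Fin 2) {N : ℕ} {M : ℝ}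
    {v : Fock (Orb (FermionTorus 2 L))} (hv : v ∈ szSector N M) :
    momentumNumber k σ *ᵥ v ∈ szSector N M :=
  mulVec_mem_szSector_of_commute (momentumNumber_commute_totalNumber k σ)
    (momentumNumber_commute_spinZ k σ) hv

/-! ### Pair modes against occupation-diagonal weights -/

/-- **`b_k† b_k = n_{k↑} n_{-k↓}`** (`b_k = c_{-k↓} c_{k↑}`). von Delft–Ralph (2001) §4.2.3.
[folklore] -/
theorem conjTranspose_pairMode_mul_self (k : TorusSite 2 L) :
    (pairMode k)ᴴ * pairMode k = momentumNumber k 0 * momentumNumber (-k) 1 := by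
  have h : ¬ (-k = k ∧ (1 : Fin 2) = 0) := fun h => absurd h.2 (by decide)
  rw [pairMode_conjTranspose, pairMode, Matrix.mul_assoc,
    ← Matrix.mul_assoc (momentumCreation (-k) 1), ← momentumNumber,
    momentumNumber_mul_momentumAnnihilation_of_ne h, ← Matrix.mul_assoc, ← momentumNumber]

/-- **Diagonal-ensemble selection rule.** If `P` commutes with `n_{k'↑}` then the cross pair
correlation `tr (P b_k† b_{k'})` vanishes for `k ≠ k'`: write `c_{k'↑} = c_{k'↑} n_{k'↑}`, cycle
`n_{k'↑}` through `P` (trace cyclicity and `[P, n_{k'↑}] = 0`) to the front of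
`b_k† c_{-k'↓} = c†_{k↑} c†_{-k↓} c_{-k'↓}`, where it commutes through the three foreign modes and dies
on `n_{k'↑} c_{k'↑} = 0`. Bardeen–Cooper–Schrieffer (1957) §II; Yang (1962) §3. [folklore] -/
theorem trace_mul_conjTranspose_pairMode_mul_pairMode_of_ne
    {P : Matrix (Finset (Orb (FermionTorus 2 L))) (Finset (Orb (FermionTorus 2 L))) ℂ}
    {k k' : TorusSite 2 L} (hk : k ≠ k') (hP : Commute P (momentumNumber k' 0)) :
    (P * ((pairMode k)ᴴ * pairMode k')).trace = 0 := by
  have h1 : ¬ (k' = k ∧ (0 : Fin 2) = 0) := fun h => hk h.1.symm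
  have h2 : ¬ (k' = -k ∧ (0 : Fin 2) = 1) := fun h => absurd h.2 (by decide)
  have h3 : ¬ (k' = -k' ∧ (0 : Fin 2) = 1) := fun h => absurd h.2 (by decide)
  -- `n_{k'↑}` commutes with `Y = c†_{k↑} c†_{-k↓} c_{-k'↓}`
  have hnY : momentumNumber k' 0 *
        (momentumCreation k 0 * momentumCreation (-k) 1 * momentumAnnihilation (-k') 1) =
      momentumCreation k 0 * momentumCreation (-k) 1 * momentumAnnihilation (-k') 1 *
        momentumNumber k' 0 := by
    rw [← Matrix.mul_assoc, ← Matrix.mul_assoc, momentumNumber_mul_momentumCreation_of_ne h1,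
      Matrix.mul_assoc (momentumCreation k 0), momentumNumber_mul_momentumCreation_of_ne h2,
      ← Matrix.mul_assoc, Matrix.mul_assoc _ (momentumNumber k' 0),
      momentumNumber_mul_momentumAnnihilation_of_ne h3, ← Matrix.mul_assoc]
  have hX : (pairMode k)ᴴ * pairMode k' =
      momentumCreation k 0 * momentumCreation (-k) 1 * momentumAnnihilation (-k') 1 *
        (momentumAnnihilation k' 0 * momentumNumber k' 0) := by
    rw [momentumAnnihilation_mul_momentumNumber_self, pairMode_conjTranspose, pairMode]
    simp only [Matrix.mul_assoc]
  calc (P * ((pairMode k)ᴴ * pairMode k')).trace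
      = (P * (momentumCreation k 0 * momentumCreation (-k) 1 * momentumAnnihilation (-k') 1 *
          momentumAnnihilation k' 0) * momentumNumber k' 0).trace := by
        rw [hX]; simp only [Matrix.mul_assoc]
    _ = (momentumNumber k' 0 * (P * (momentumCreation k 0 * momentumCreation (-k) 1 *
          momentumAnnihilation (-k') 1 * momentumAnnihilation k' 0))).trace := Matrix.trace_mul_comm _ _
    _ = (P * (momentumCreation k 0 * momentumCreation (-k) 1 * momentumAnnihilation (-k') 1 *
          (momentumNumber k' 0 * momentumAnnihilation k' 0))).trace := by
        rw [← Matrix.mul_assoc (momentumNumber k' 0) P, ← hP.eq, Matrix.mul_assoc P,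
          ← Matrix.mul_assoc (momentumNumber k' 0), hnY, Matrix.mul_assoc _ (momentumNumber k' 0)]
    _ = 0 := by
        rw [momentumNumber_mul_momentumAnnihilation_self, Matrix.mul_zero, Matrix.mul_zero,
          trace_zero]

/-- `B(ĝ,S)† B(ĝ,S) = Σ_{k,k' ∈ S} ĝ(k) ĝ(k') b_k† b_{k'}` (real form factor). [folklore] -/
theorem conjTranspose_pairOperator_mul_pairOperator (ĝ : TorusSite 2 L → ℝ)
    (S : Finset (TorusSite 2 L)) :
    (pairOperator ĝ S)ᴴ * pairOperator ĝ S =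
      ∑ k ∈ S, ∑ k' ∈ S, ((ĝ k : ℂ) * (ĝ k' : ℂ)) • ((pairMode k)ᴴ * pairMode k') := by
  have hct : (pairOperator ĝ S)ᴴ = ∑ k ∈ S, (ĝ k : ℂ) • (pairMode k)ᴴ := by
    simp only [pairOperator, conjTranspose_sum, conjTranspose_smul, Complex.star_def,
      Complex.conj_ofReal]
  rw [hct, pairOperator, Finset.sum_mul_sum]
  refine Finset.sum_congr rfl fun k _ => Finset.sum_congr rfl fun k' _ => ?_
  rw [smul_mul_smul_comm]

/-- **"Wick's rule" for occupation-diagonal weights.** If `P` commutes with `n_{k↑}` for every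
`k ∈ S`, then `tr (P B(ĝ,S)† B(ĝ,S)) = Σ_{k ∈ S} ĝ(k)² tr (P n_{k↑} n_{-k↓})`: the cross terms die by
the selection rule, the diagonal ones are `b_k† b_k = n_{k↑} n_{-k↓}`.
Bardeen–Cooper–Schrieffer (1957) §II. [folklore] -/
theorem trace_mul_conjTranspose_pairOperator_mul_pairOperator
    {P : Matrix (Finset (Orb (FermionTorus 2 L))) (Finset (Orb (FermionTorus 2 L))) ℂ}
    (ĝ : TorusSite 2 L → ℝ) {S : Finset (TorusSite 2 L)}
    (hP : ∀ k ∈ S, Commute P (momentumNumber k 0)) :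
    (P * ((pairOperator ĝ S)ᴴ * pairOperator ĝ S)).trace =
      ∑ k ∈ S, (ĝ k : ℂ) ^ 2 * (P * (momentumNumber k 0 * momentumNumber (-k) 1)).trace := by
  rw [conjTranspose_pairOperator_mul_pairOperator, Finset.mul_sum, trace_sum]
  refine Finset.sum_congr rfl fun k hk => ?_
  rw [Finset.mul_sum, trace_sum, Finset.sum_eq_single_of_mem k hk]
  · rw [Matrix.mul_smul, trace_smul, conjTranspose_pairMode_mul_self, smul_eq_mul, sq]
  · intro k' hk' hne
    rw [Matrix.mul_smul, trace_smul,
      trace_mul_conjTranspose_pairMode_mul_pairMode_of_ne (Ne.symm hne) (hP k' hk'), smul_zero]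

/-- `0 ≤ Re tr (P n_{k↑} n_{-k↓}) ≤ Re tr P` for a Hermitian idempotent `P` commuting with
`n_{k↑}` and `n_{-k↓}` (all three are commuting orthogonal projections). [folklore] -/
theorem re_trace_mul_momentumNumber_mul_momentumNumber_mem_Icc
    {P : Matrix (Finset (Orb (FermionTorus 2 L))) (Finset (Orb (FermionTorus 2 L))) ℂ}
    (hPh : Pᴴ = P) (hPP : P * P = P) (k : TorusSite 2 L)
    (h0 : Commute P (momentumNumber k 0)) (h1 : Commute P (momentumNumber (-k) 1)) :
    (P * (momentumNumber k 0 * momentumNumber (-k) 1)).trace.re ∈ Set.Icc 0 P.trace.re := by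
  have hA : (momentumNumber k 0 * momentumNumber (-k) 1)ᴴ = momentumNumber k 0 * momentumNumber (-k) 1 := by
    rw [conjTranspose_mul, momentumNumber_conjTranspose, momentumNumber_conjTranspose]
    exact (momentumNumber_commute _ _ _ _).eq
  have hAA : momentumNumber k 0 * momentumNumber (-k) 1 * (momentumNumber k 0 * momentumNumber (-k) 1) =
      momentumNumber k 0 * momentumNumber (-k) 1 := by
    rw [Matrix.mul_assoc, ← Matrix.mul_assoc (momentumNumber (-k) 1) (momentumNumber k 0),
      (momentumNumber_commute (-k) k 1 0).eq, Matrix.mul_assoc, momentumNumber_mul_self,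
      ← Matrix.mul_assoc, momentumNumber_mul_self]
  have hc : Commute P (momentumNumber k 0 * momentumNumber (-k) 1) := h0.mul_right h1
  exact ⟨re_trace_mul_nonneg_of_commute hPh hPP hA hAA hc,
    re_trace_mul_le_of_commute hPh hPP hA hAA hc⟩

/-! ### The `d`-wave pair field -/

/-- `Δ_d† Δ_d = 8 · B(ĝ_d)† B(ĝ_d)` for `Δ_d = pairField dWaveFormFactor L = -2√2 B(ĝ_d)`,
`B(ĝ_d) = pairOperator dWaveGap univ`. Scalapino (1995) §2. [folklore] -/
theorem conjTranspose_pairField_dWave_mul_self :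
    (pairField dWaveFormFactor L)ᴴ * pairField dWaveFormFactor L =
      ((8 : ℝ) : ℂ) • ((pairOperator dWaveGap (Finset.univ : Finset (TorusSite 2 L)))ᴴ *
        pairOperator dWaveGap (Finset.univ : Finset (TorusSite 2 L))) := by
  rw [pairField_dWave_eq_smul_pairOperator, conjTranspose_neg, conjTranspose_smul, neg_mul_neg,
    smul_mul_smul_comm, Complex.star_def, Complex.conj_ofReal, ← Complex.ofReal_mul]
  congr 2
  have h2 : Real.sqrt 2 * Real.sqrt 2 = 2 := Real.mul_self_sqrt (by norm_num)
  nlinarith [h2]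

/-- **Occupation-diagonal states have no `d`-wave pair LRO.** For a Hermitian idempotent `P`
commuting with every Bloch occupation number `n_{kσ}` of the fermionic torus of side `L`,
`Re tr (P Δ_d† Δ_d) ≤ 32 · L² · Re tr P` (`= 8 Σ_k ĝ_d(k)² Re tr (P n_{k↑} n_{-k↓})` with
`0 ≤ Re tr (P n_{k↑} n_{-k↓}) ≤ Re tr P`, `ĝ_d² ≤ 4`, `|(ℤ/Lℤ)²| = L²`).
Bardeen–Cooper–Schrieffer (1957) §II; Yang (1962) §3. [folklore] -/
theorem re_trace_mul_conjTranspose_pairField_dWave_mul_le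
    {P : Matrix (Finset (Orb (FermionTorus 2 L))) (Finset (Orb (FermionTorus 2 L))) ℂ}
    (hPh : Pᴴ = P) (hPP : P * P = P) (hP : ∀ (k : TorusSite 2 L) (σ : Fin 2), Commute P (momentumNumber k σ)) :
    (P * ((pairField dWaveFormFactor L)ᴴ * pairField dWaveFormFactor L)).trace.re ≤
      32 * (L : ℝ) ^ 2 * P.trace.re := by
  rw [conjTranspose_pairField_dWave_mul_self, Matrix.mul_smul, trace_smul, smul_eq_mul,
    trace_mul_conjTranspose_pairOperator_mul_pairOperator dWaveGap (fun k _ => hP k 0),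
    Complex.re_ofReal_mul, Complex.re_sum]
  have hterm : ∀ k : TorusSite 2 L,
      ((dWaveGap k : ℂ) ^ 2 * (P * (momentumNumber k 0 * momentumNumber (-k) 1)).trace).re ≤
        4 * P.trace.re := by
    intro k
    rw [← Complex.ofReal_pow, Complex.re_ofReal_mul]
    obtain ⟨h0, h1⟩ := re_trace_mul_momentumNumber_mul_momentumNumber_mem_Icc hPh hPP k (hP k 0)
      (hP (-k) 1)
    have hg : dWaveGap k ^ 2 ≤ 4 := by
      unfold dWaveGap
      have h1 := Real.abs_cos_le_one (latticeMomentum L k 0)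
      have h2 := Real.abs_cos_le_one (latticeMomentum L k 1)
      rw [abs_le] at h1 h2
      nlinarith
    have hg0 : 0 ≤ dWaveGap k ^ 2 := sq_nonneg _
    nlinarith
  have hsum : ∑ k : TorusSite 2 L,
      ((dWaveGap k : ℂ) ^ 2 * (P * (momentumNumber k 0 * momentumNumber (-k) 1)).trace).re ≤
        (L : ℝ) ^ 2 * (4 * P.trace.re) := by
    calc _ ≤ ∑ _k : TorusSite 2 L, 4 * P.trace.re := Finset.sum_le_sum fun k _ => hterm k
      _ = (L : ℝ) ^ 2 * (4 * P.trace.re) := by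
          rw [Finset.sum_const, Finset.card_univ, card_torusSite, nsmul_eq_mul]
          push_cast
          ring
  nlinarith

/-! ### The free Hubbard torus: sector eigen-projections are occupation-diagonal -/

/-- At `U = 0` (and `L ≥ 3`) every Bloch occupation number commutes with the torus Hubbard
Hamiltonian `H(1,0) = Σ_{kσ} ε_L(k) n_{kσ}`. Benfatto–Giuliani–Mastropietro (2006) §1.2. [folklore] -/
theorem momentumNumber_commute_hubbardTorus_zero (hL : 3 ≤ L) (k : TorusSite 2 L) (σ : Fin 2) :
    Commute (momentumNumber k σ) (hubbardTorus 2 L 1 0) := by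
  rw [hubbardTorus_zero_eq_sum_momentumNumber hL]
  exact Commute.sum_right _ _ _ fun k' _ => Commute.sum_right _ _ _ fun σ' _ =>
    (momentumNumber_commute k k' σ σ').smul_right _

/-- At `U = 0` (`L ≥ 3`), `n_{kσ}` leaves every joint sector eigenspace
`szSector N M ⊓ ker (H(1,0) - e)` invariant. [folklore] -/
theorem momentumNumber_mulVec_mem_sectorEigenspace_free (hL : 3 ≤ L) (k : TorusSite 2 L)
    (σ : Fin 2) (N : ℕ) (M : ℝ) (e : ℂ) {v : Fock (Orb (FermionTorus 2 L))}
    (hv : v ∈ szSector (Λ := FermionTorus 2 L) N M ⊓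
      Module.End.eigenspace (Matrix.toLin' (hubbardTorus 2 L 1 0)) e) :
    momentumNumber k σ *ᵥ v ∈ szSector (Λ := FermionTorus 2 L) N M ⊓
      Module.End.eigenspace (Matrix.toLin' (hubbardTorus 2 L 1 0)) e := by
  rw [Submodule.mem_inf] at hv ⊢
  exact ⟨momentumNumber_mulVec_mem_szSector k σ hv.1,
    mulVec_mem_eigenspace_of_commute (momentumNumber_commute_hubbardTorus_zero hL k σ) hv.2⟩

/-- At `U = 0` (`L ≥ 3`), the orthogonal projection onto any joint sector eigenspace
`E = szSector N M ⊓ ker (H(1,0) - e)` commutes with every `n_{kσ}`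
(`projMatrix_map_commute_of_invariant`). [folklore] -/
theorem projMatrix_sectorEigenspace_free_commute_momentumNumber (hL : 3 ≤ L) (N : ℕ) (M : ℝ)
    (e : ℂ) (k : TorusSite 2 L) (σ : Fin 2) :
    Commute (projMatrix ((szSector (Λ := FermionTorus 2 L) N M ⊓
        Module.End.eigenspace (Matrix.toLin' (hubbardTorus 2 L 1 0)) e).map
          ((WithLp.linearEquiv 2 ℂ (Finset (Orb (FermionTorus 2 L)) → ℂ)).symm :
            (Finset (Orb (FermionTorus 2 L)) → ℂ) →ₗ[ℂ]
              EuclideanSpace ℂ (Finset (Orb (FermionTorus 2 L))))))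
      (momentumNumber k σ) := by
  have hH : (momentumNumber k σ).IsHermitian := momentumNumber_conjTranspose k σ
  exact projMatrix_map_commute_of_invariant hH _
    fun v hv => momentumNumber_mulVec_mem_sectorEigenspace_free hL k σ N M e hv

/-- **The free Fermi gas has no sector-average `d`-wave pair LRO.** For the free (`U = 0`, `t = 1`)
Hubbard Hamiltonian on the fermionic torus `(ℤ/Lℤ)²`, `L ≥ 3`, any particle number `N`, any
`S^z = M`, any `e`, and `P` the orthogonal projection onto the joint sector eigenspace
`szSector N M ⊓ ker (H(1,0) - e)` (in particular onto the sector GROUND eigenspace,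
`e = minEnergyOn`): `Re tr (P Δ_d† Δ_d) ≤ 32 · L² · Re tr P`, where `Re tr P = dim E` — an `L²`
law, incompatible with pair LRO `c·L⁴·Re tr P ≤ Re tr (P Δ_d†Δ_d)` as soon as `L² > 32/c`.
Bardeen–Cooper–Schrieffer (1957) §II; Yang (1962) §3. [folklore] -/
theorem re_trace_sectorEigenProj_mul_pairField_dWave_le_free (hL : 3 ≤ L) (N : ℕ) (M : ℝ)
    (e : ℂ) :
    let E := szSector (Λ := FermionTorus 2 L) N M ⊓
      Module.End.eigenspace (Matrix.toLin' (hubbardTorus 2 L 1 0)) e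
    let P := projMatrix (E.map
      ((WithLp.linearEquiv 2 ℂ (Finset (Orb (FermionTorus 2 L)) → ℂ)).symm :
        (Finset (Orb (FermionTorus 2 L)) → ℂ) →ₗ[ℂ] EuclideanSpace ℂ (Finset (Orb (FermionTorus 2 L)))))
    (P * ((pairField dWaveFormFactor L)ᴴ * pairField dWaveFormFactor L)).trace.re ≤
      32 * (L : ℝ) ^ 2 * P.trace.re := by
  intro E P
  exact re_trace_mul_conjTranspose_pairField_dWave_mul_le (projMatrix_isHermitian _).eq
    (projMatrix_mul_self _)
    fun k σ => projMatrix_sectorEigenspace_free_commute_momentumNumber hL N M e k σ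

end MomentumNumber

end Literature.MathematicalPhysics.QuantumLattice
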